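import Mathlib
import HarnessLib
import Summits.ResolutionOfSingularities.ResolutionOfSingularities.Theorems.WildQuotientsWildQuotientResolutionS1aGraphMemberAway
import Summits.ResolutionOfSingularities.ResolutionOfSingularities.Theorems.WildQuotientsWildQuotientResolutionS1aNodeChartAway

/-!
# S1a — R4c cusp, brick (b3-transfer): ROWS AND DEGREES ON A LOCALISED CHART MODEL `Φ′ : B[1/b] ≃ K[1/(q b′)]`

[OURS · L1 W4.5c · lead-1 g17; plan-1 RULING R-F15v (2) ★ R4c `cusp_killsIn_two`, memo `Cruxes/CyclicQuotientFourfolds/Lines/s1a_logminvertex-R4c-PROGRESS.md` §2/§4 (b3′):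
the member charts of the cusp are invariant basic opens `D(b)` of producer charts; their node is the localised node `(B[1/b], locPiece, σ_b)` (✓`NodeChartAway.exists_nodeData_basicOpen`)
and their free model is the localised model `Φ′` of ✓`FreeModel.exists_awayModelEquiv`, characterised by the pin `Φ′((Φ⁻¹(a/1))/1) = a/1`. From that pin alone this file
TRANSFERS to `Φ′`: the rows of `conj Φ σ` on polynomial images (`conj_away_algebraMap`), fixed inverted elements (`conj_away_invSelf`), and homogeneity degrees into
`mapGrading (locPiece 𝒜) Φ′` (`algebraMap_mem_mapGrading_away`) — exactly the hypotheses `hs … hφ`, `hfix`, `hX₀d`, `hφd` of ✓`exists_principalCentreChartSec_of_symMemberGraph`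
on the localised chart] — NOT statements of the manuscript; counted 0; AI-level work, weaker than expert review. Crux stmt-ResolutionOfSingularities-17941 `CyclicQuotientFourfolds`,
line `s1a-logminvertex` v13 (`stub_reachLowerInFX`).
-/

set_option linter.dupNamespace false

noncomputable section

open Summit.ResolutionOfSingularities.ResolutionOfSingularities.Theorems.WildQuotientResolution.S1
open Summit.ResolutionOfSingularities.ResolutionOfSingularities.Theorems.WildQuotientResolution.S1.GradedLocalization
open Summit.ResolutionOfSingularities.ResolutionOfSingularities.Theorems.WildQuotientResolution.S1.NodeTransport
open Summit.ResolutionOfSingularities.ResolutionOfSingularities.Theorems.WildQuotientResolution.S1.NodeAway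

namespace Summit.ResolutionOfSingularities.ResolutionOfSingularities.Theorems.WildQuotientResolution.S1.FreeModel

variable {B : Type} [CommRing B] {K : Type} [CommRing K] (q b' : K) (Φ : B ≃+* Localization.Away q) (b : B) (σ : B ≃+* B) (hσb : σ b = b)
  (Φ' : Localization.Away b ≃+* Localization.Away (q * b'))
  (hpin : ∀ a : K, Φ' (algebraMap B (Localization.Away b) (Φ.symm (algebraMap K (Localization.Away q) a))) = algebraMap K (Localization.Away (q * b')) a)

include hpin in
/-- **Row transfer**: a row `conj Φ σ (a/1) = a′/1` of the producer model gives the row `conj Φ′ σ_b (a/1) = a′/1` of the localised model. [OURS · L1 W4.5c · R4c] -/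
theorem conj_away_algebraMap (a a' : K) (h : conj Φ σ (algebraMap K (Localization.Away q) a) = algebraMap K (Localization.Away q) a') :
    conj Φ' (sigmaAway σ hσb) (algebraMap K (Localization.Away (q * b')) a) = algebraMap K (Localization.Away (q * b')) a' := by
  have e1 : Φ'.symm (algebraMap K (Localization.Away (q * b')) a) = algebraMap B (Localization.Away b) (Φ.symm (algebraMap K (Localization.Away q) a)) := by
    rw [← hpin a, Φ'.symm_apply_apply]
  have e2 : σ (Φ.symm (algebraMap K (Localization.Away q) a)) = Φ.symm (algebraMap K (Localization.Away q) a') := by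
    rw [← h, conj_apply, Φ.symm_apply_apply]
  rw [conj_apply, e1, sigmaAway_algebraMap, e2, hpin]

include hpin in
/-- **Fixed inverted element**: if `conj Φ σ` fixes `(q b′)/1`, then `conj Φ′ σ_b` fixes `(q b′)⁻¹`. [OURS · L1 W4.5c · R4c] -/
theorem conj_away_invSelf (hq : conj Φ σ (algebraMap K (Localization.Away q) (q * b')) = algebraMap K (Localization.Away q) (q * b')) :
    conj Φ' (sigmaAway σ hσb) (IsLocalization.Away.invSelf (q * b')) = IsLocalization.Away.invSelf (q * b') :=
  KillCert.QhAway.map_invSelf_of_map_algebraMap (q * b') _ (conj_away_algebraMap q b' Φ b σ hσb Φ' hpin _ _ hq)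

include hpin in
/-- **Fixed set transfer**: `conj Φ′ σ_b` fixes `(q b′)⁻¹` and every `a/1` with `conj Φ σ (a/1) = a/1` for `a` in a set `S` (e.g. the constants). [OURS · L1 W4.5c · R4c] -/
theorem conj_away_fix (S : Set K) (hS : ∀ a ∈ S, conj Φ σ (algebraMap K (Localization.Away q) a) = algebraMap K (Localization.Away q) a)
    (hq : conj Φ σ (algebraMap K (Localization.Away q) (q * b')) = algebraMap K (Localization.Away q) (q * b')) :
    ∀ g ∈ (({IsLocalization.Away.invSelf (q * b')} : Set (Localization.Away (q * b'))) ∪ (algebraMap K (Localization.Away (q * b'))) '' S),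
      conj Φ' (sigmaAway σ hσb) g = g := by
  rintro g (hg | ⟨a, ha, rfl⟩)
  · rw [Set.mem_singleton_iff.mp hg]
    exact conj_away_invSelf q b' Φ b σ hσb Φ' hpin hq
  · exact conj_away_algebraMap q b' Φ b σ hσb Φ' hpin a a (hS a ha)

include hpin in
/-- **Degree transfer**: a polynomial image `a/1` homogeneous of degree `d` for the producer grading transported by `Φ` is homogeneous of degree `d` for the LOCALISED
grading `locPiece 𝒜` transported by `Φ′`. [OURS · L1 W4.5c · R4c] -/
theorem algebraMap_mem_mapGrading_away {ι : Type} [AddCommGroup ι] [DecidableEq ι] (𝒜 : ι → AddSubgroup B) [GradedRing 𝒜] (hb : b ∈ 𝒜 0) {d : ι} (a : K)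
    (h : algebraMap K (Localization.Away q) a ∈ mapGrading 𝒜 Φ d) :
    algebraMap K (Localization.Away (q * b')) a ∈ mapGrading (locPiece 𝒜 hb) Φ' d := by
  rw [← hpin a]
  exact (map_mem_mapGrading_iff (locPiece 𝒜 hb) Φ').mpr (algebraMap_mem_locPiece 𝒜 hb ((mem_mapGrading_iff 𝒜 Φ).mp h))

/-- **Units**: every divisor of `q·b′` becomes a unit of `K[1/(q b′)]` (the inverted norms, the member-row unit `h`, the variables dividing the cover elements). [folklore] -/
theorem isUnit_algebraMap_of_dvd_mul {a : K} (ha : a ∣ q * b') : IsUnit (algebraMap K (Localization.Away (q * b')) a) :=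
  IsLocalization.Away.isUnit_of_dvd (x := q * b') ha

end Summit.ResolutionOfSingularities.ResolutionOfSingularities.Theorems.WildQuotientResolution.S1.FreeModel

end
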